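import Literature.MathematicalPhysics.QuantumLattice.HubbardNNNHoppingTorusLimitCorrelator
import HarnessLib

/-!
# `t–t'` Hubbard model: the AFFINE («Lagrangian») thermodynamic-limit edge of a window certificate —
# what the certificate proves about torus-limit ground states BEFORE any energy window is inserted

Family `hubbard` (topic `MathematicalPhysics/QuantumLattice`). Companion of
`HubbardNNNHoppingTorusLimitCorrelator`: there,
`InfVolFermionState.IsTorusLimitOf.re_sum_expect_d4_ge_of_window_certificate_TT'_ineq` passes the
finite-torus bound of `re_orbitState_ge_of_window_certificate_d4_TT'_ineq` — constant
`c − Σₖ ‖aₖ‖ + (Σ_σ μ_σ)(n_L/L² − ν)` PLUS the signed energy slack `κ (u − E_L/L²)` — to torus-limit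
ground states and then DROPS the limit slack `κ (u − e₀) ≥ 0` using `κ ≥ 0` and a certified cap
`e₀ := energyDensityTT' t t' U n ≤ u`. The inequality one line before the slack is dropped is the
sharper and more useful statement (Wang et al. 2024 §III: weak duality is an IDENTITY in the energy
right-hand side; Boyd–Vandenberghe §5.6: the optimal value is affine in the constraint level with slope
the multiplier): for EVERY torus limit `ω` of unit sector ground states, with NO hypothesis on the sign
of `κ` and NO energy hypothesis,

  `c − Σₖ ‖aₖ‖ + (Σ_σ μ_σ)(n/2 − ν) + κ (u − e₀) ≤ |S|⁻¹ Σ_{γ ∈ S} Re ω_{γΛ'}(Γ(d4Emb γ 0) X)`,   (★)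

an AFFINE inequality in the one unknown real `e₀ = energyDensityTT' t t' U n`. This file proves (★)
and its two-slot form (a cap multiplier `κhi` on `hi·1 − Γ E_Φ` AND a floor multiplier `κlo` on
`Γ E_Φ − lo·1`, the shape in which SDP window certificates are emitted):

* `InfVolFermionState.IsTorusLimitOf.re_sum_expect_d4_ge_of_window_certificate_TT'_affine` — (★),
  `D₄`-orbit-mean form (the honest conclusion of a point-group-reduced certificate), one energy slot
  `(κ, u)`, `κ` of either sign;
* `InfVolFermionState.IsTorusLimitOf.re_sum_expect_d4_ge_of_window_certificate_TT'_affine₂` — the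
  same with two energy slots: identity
  `X − c·1 − Σ_σ μ_σ (n_{0σ} − ν·1) − κhi (hi·1 − Γ E_Φ) − κlo (Γ E_Φ − lo·1) = (Han's families)`
  ⟹ `c − Σₖ ‖aₖ‖ + (Σ_σ μ_σ)(n/2 − ν) + κhi (hi − e₀) + κlo (e₀ − lo) ≤ orbit mean`
  (reduction to one slot: `κ := κhi − κlo`, `u := 0`, `c := c + κhi·hi − κlo·lo` — no division);
* `InfVolFermionState.IsTorusLimitOf.re_expect_ge_of_window_certificate_TT'_affine` /
  `InfVolFermionState.IsTorusLimitOf.re_expect_ge_of_window_certificate_TT'_affine₂` — translation-only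
  certificates (`S = {1}`, all `γₗ = 1`): the bound is on `Re ω_{Λ'}(X)` itself;
(The tree's capped statement `…_TT'_ineq` is (★) plus `κ (u − e₀) ≥ 0`; it is not restated here.)

WHY IT MATTERS (the venture's «fast layer», D-0042 R1b): (★) is exactly the predicate
`SquareTTPrimeCorrAffineOrbitLowerRow` of `Summits/Ventures/CertifiedManyBodySolver/Rows/DopedTLCorrAffine.lean`
(affine claim nodes, re-priced under any later energy window at zero solver cost); before this file that
predicate's justification was a sentence about an inequality INSIDE the proof of the capped theorem.
Everything is PROVED (no definition, no named fact, no `sorry`); the proof of (★) is the tree's proof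
with the last two lines (the slack drop) removed.

## References
* J. Wang, J. Surace, I. Frérot, B. Legat, M.-O. Renou, V. Magron, A. Acín, *Certifying ground-state
  properties of many-body systems*, Phys. Rev. X 14 (2024) 031006, §III (energy constraint in the
  relaxation of `⟨O⟩`; the bound as a function of `E_up`). [cite: WangEtAl2024, §III]
* S. Boyd, L. Vandenberghe, *Convex Optimization* (2004), §5.6 (perturbation and sensitivity analysis:
  the optimal value is bounded by the affine function with slope the dual variables).
  [cite: BoydVandenberghe2004, §5.6]
* X. Han, *Quantum many-body bootstrap*, arXiv:2006.06002 (2020), §3. [cite: Han2020Bootstrap, §3]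
* O. Bratteli, D. W. Robinson, *Operator Algebras and Quantum Statistical Mechanics II*, 2nd ed.
  (1997), §6.2.4. [cite: BratteliRobinsonII1997, §6.2.4]
-/

noncomputable section

namespace Literature.MathematicalPhysics.QuantumLattice

open Matrix Finset HubbardWave0 Literature.Probability.LatticeModels
open Literature.MathematicalPhysics.QuantumManyBody.StateRelaxation
open _root_.Filter
open scoped ComplexOrder BigOperators _root_.Topology

section Limit

/-- Card of the fermionic torus `(ℤ/Lℤ)²`. [folklore] -/
private theorem card_fermionTorus_two_aff (L : ℕ) : Fintype.card (FermionTorus 2 L) = L ^ 2 := by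
  simp [FermionTorus]

/-- Half the sector particle number is at most the number of sites (`0 ≤ n ≤ 2`). [folklore] -/
private theorem half_rectN_le_card_aff {n : ℝ} (hn0 : 0 ≤ n) (hn2 : n ≤ 2) (L : ℕ) :
    ⌊n * (L : ℝ) ^ 2 / 2⌋₊ ≤ Fintype.card (FermionTorus 2 L) := by
  have h := ThermodynamicLimit.rectN_le_two_mul hn0 hn2 L
  have hrect : ThermodynamicLimit.rectN n L = 2 * ⌊n * (L : ℝ) ^ 2 / 2⌋₊ := rfl
  rw [hrect, ← sq] at h
  rw [card_fermionTorus_two_aff]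
  exact Nat.le_of_mul_le_mul_left h two_pos

/-- **AFFINE thermodynamic-limit edge of a window certificate (one energy slot, `κ` of either sign, no
energy hypothesis).** Data: the window identity of `re_orbitState_ge_of_window_certificate_d4_TT'_ineq`
(objective `X ∈ 𝔄_{Λ'}`, density multipliers `μ_σ`, `ν`, energy term `κ (u·1 − Γ(incl) E^{tt'}_Φ)`, Han's
constraint families, point-group labels `γₗ ∈ S` for a finite `S ∋ 1` closed under multiplication),
`U ≥ 0`, `0 ≤ n < 2`. Let `ψ_L` be unit ground states of the sectors `(rectN n L, S^z = 0)` of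
`hubbardTorusTT' L t t' U` along sides `Ls → ∞`, and `ω` a torus limit of `ψ` along `Ls`. Then, with
`e₀ := energyDensityTT' t t' U n`,
`c − Σₖ ‖aₖ‖ + (Σ_σ μ_σ)(n/2 − ν) + κ (u − e₀) ≤ |S|⁻¹ Σ_{γ∈S} Re ω_{γΛ'}(Γ(d4Emb γ 0) X)`
— the weak-duality inequality as an AFFINE function of the energy level (finite tori: the orbit-state
bound with slack `κ (u − E_L/L²)`; `E_L/L² → e₀` by `tendsto_energyDensityTT'_torus`, `rectN n L/L² → n`).
Wang et al. 2024 §III; Boyd–Vandenberghe §5.6. [cite: WangEtAl2024, §III] -/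
theorem InfVolFermionState.IsTorusLimitOf.re_sum_expect_d4_ge_of_window_certificate_TT'_affine
    (t t' : ℝ) {U : ℝ} (hU : 0 ≤ U) {n : ℝ} (hn0 : 0 ≤ n) (hn2 : n < 2) (κ u : ℝ)
    {Λ Λ' : Finset (Site 2)} (hΛ : Λ ⊆ Λ') (h8 : thicken Λ 1 ⊆ Λ')
    (h0 : thicken ({0} : Finset (Site 2)) 1 ⊆ Λ') (hz : (0 : Site 2) ∈ Λ')
    {S : Finset (DihedralGroup 4)} (h1 : (1 : DihedralGroup 4) ∈ S) (hmul : ∀ a ∈ S, ∀ b ∈ S, a * b ∈ S)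
    (Xw : FermionOp Λ') (μ : Fin 2 → ℝ) (ν : ℝ)
    {m : Type*} [Fintype m] [DecidableEq m] {Λm : Matrix m m ℂ} (hΛm : Λm.PosSemidef)
    (O : m → FermionOp Λ')
    {κ' : Type*} (s : Finset κ') (B : κ' → FermionOp Λ)
    {ι : Type*} (tt : Finset ι) (γ : ι → DihedralGroup 4) (hγS : ∀ l ∈ tt, γ l ∈ S) (wv : ι → Site 2)
    (hsh : ∀ l, d4ShiftSet (γ l) (wv l) Λ ⊆ Λ') (Y : ι → FermionOp Λ)
    {ρ : Type*} (uu : Finset ρ) (b : ρ → ℂ) (cw : ρ → List (Orb (PolySite Λ') × Bool))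
    (hcw : ∀ j ∈ uu, ladderCharge (cw j) ≠ 0 ∨ ladderSpinCharge (cw j) ≠ 0)
    {δ : Type*} (ah : Finset δ) (dc : δ → ℝ) (V : δ → FermionOp Λ')
    {κ'' : Type*} (w : Finset κ'') (a : κ'' → ℂ) (word : κ'' → List (Orb (PolySite Λ') × Bool)) {c : ℝ}
    (hcert : Xw - (c : ℂ) • (1 : FermionOp Λ') -
        ∑ σ : Fin 2, ((μ σ : ℝ) : ℂ) • (nAt 0 hz σ - ((ν : ℝ) : ℂ) • (1 : FermionOp Λ')) -
        ((κ : ℝ) : ℂ) • (((u : ℝ) : ℂ) • (1 : FermionOp Λ') -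
          fermionEmbed (PolySite.incl h0) ((hubbardTTPrimeFermionInteraction t t' U).meanEnergyObs 1)) =
      gramForm Λm O +
        (∑ k ∈ s, ((hubbardTTPrimeFermionInteraction t t' U).localHamiltonian Λ' * fermionEmbed (PolySite.incl hΛ) (B k) -
            fermionEmbed (PolySite.incl hΛ) (B k) * (hubbardTTPrimeFermionInteraction t t' U).localHamiltonian Λ') +
          ∑ l ∈ tt, (fermionEmbed (PolySite.incl (hsh l)) (fermionEmbed (PolySite.d4Emb (γ l) (wv l) Λ) (Y l)) -
            fermionEmbed (PolySite.incl hΛ) (Y l)) +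
          ∑ j ∈ uu, b j • ladderWord (cw j)) +
        (∑ m' ∈ ah, ((dc m' : ℝ) : ℂ) • ((V m')ᴴ - V m') + ∑ k ∈ w, a k • ladderWord (word k)))
    {Ls : ℕ → ℕ} (hLs : Tendsto Ls atTop atTop)
    {ψ : ∀ L, Fock (Orb (FermionTorus 2 L))}
    (hψ : ∀ j, IsGroundStateInSector (hubbardTorusTT' (Ls j) t t' U)
      (ThermodynamicLimit.rectN n (Ls j)) 0 (ψ (Ls j)))
    (hψ1 : ∀ j, star (ψ (Ls j)) ⬝ᵥ ψ (Ls j) = 1)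
    {ω : InfVolFermionState 2} (hω : ω.IsTorusLimitOf ψ Ls) :
    c - ∑ k ∈ w, ‖a k‖ + (∑ σ : Fin 2, μ σ) * (n / 2 - ν) +
        κ * (u - ThermodynamicLimit.energyDensityTT' t t' U n) ≤
      (S.card : ℝ)⁻¹ * ∑ g ∈ S,
        (ω.expect (d4ShiftSet g 0 Λ') (fermionEmbed (PolySite.d4Emb g 0 Λ') Xw)).re := by
  -- the averaged torus expectations of the rotated observables converge to their values in `ω`
  have hlim : Tendsto (fun j => (S.card : ℝ)⁻¹ * ∑ g ∈ S,
      (torusAvgExpect (Ls j) (d4ShiftSet g 0 Λ') (fermionEmbed (PolySite.d4Emb g 0 Λ') Xw) (ψ (Ls j))).re)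
      atTop (𝓝 ((S.card : ℝ)⁻¹ * ∑ g ∈ S,
        (ω.expect (d4ShiftSet g 0 Λ') (fermionEmbed (PolySite.d4Emb g 0 Λ') Xw)).re)) := by
    refine (tendsto_finsetSum S fun g _ => ?_).const_mul _
    exact (Complex.continuous_re.tendsto _).comp (hω (d4ShiftSet g 0 Λ') _)
  -- the energies per site converge to the thermodynamic-limit density, the fillings to `n/2`
  have hE : Tendsto (fun j => groundEnergy (hubbardTorusTT' (Ls j) t t' U) (ThermodynamicLimit.rectN n (Ls j)) /
      ((Ls j : ℕ) : ℝ) ^ 2) atTop (𝓝 (ThermodynamicLimit.energyDensityTT' t t' U n)) :=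
    (ThermodynamicLimit.tendsto_energyDensityTT'_torus t t' hU hn0 hn2).comp hLs
  have hN : Tendsto (fun j => (ThermodynamicLimit.rectN n (Ls j) : ℝ) / 2 / ((Ls j : ℕ) : ℝ) ^ 2) atTop
      (𝓝 (n / 2)) := by
    have h := ((ThermodynamicLimit.tendsto_rectN_div_sq hn0).comp hLs).div_const 2
    refine h.congr fun j => ?_
    simp only [Function.comp_apply]
    ring
  set b0 : ℝ := c - ∑ k ∈ w, ‖a k‖ with hb0
  have hbnd : Tendsto (fun j => b0 + (∑ σ : Fin 2, μ σ) *
      ((ThermodynamicLimit.rectN n (Ls j) : ℝ) / 2 / ((Ls j : ℕ) : ℝ) ^ 2 - ν) +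
      κ * (u - groundEnergy (hubbardTorusTT' (Ls j) t t' U) (ThermodynamicLimit.rectN n (Ls j)) /
        ((Ls j : ℕ) : ℝ) ^ 2)) atTop
      (𝓝 (b0 + (∑ σ : Fin 2, μ σ) * (n / 2 - ν) + κ * (u - ThermodynamicLimit.energyDensityTT' t t' U n))) :=
    (tendsto_const_nhds.add ((hN.sub_const ν).const_mul _)).add ((tendsto_const_nhds.sub hE).const_mul κ)
  -- the finite-torus inequality holds for all large `j`
  have hev' : ∀ᶠ j in atTop, b0 + (∑ σ : Fin 2, μ σ) *
      ((ThermodynamicLimit.rectN n (Ls j) : ℝ) / 2 / ((Ls j : ℕ) : ℝ) ^ 2 - ν) +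
      κ * (u - groundEnergy (hubbardTorusTT' (Ls j) t t' U) (ThermodynamicLimit.rectN n (Ls j)) /
        ((Ls j : ℕ) : ℝ) ^ 2) ≤
      (S.card : ℝ)⁻¹ * ∑ g ∈ S,
        (torusAvgExpect (Ls j) (d4ShiftSet g 0 Λ') (fermionEmbed (PolySite.d4Emb g 0 Λ') Xw) (ψ (Ls j))).re := by
    filter_upwards [eventually_injOn_proj_of_tendsto (thicken Λ' 1) hLs, hLs.eventually_ge_atTop 3]
      with j hInj hL3
    haveI : NeZero (Ls j) := ⟨by omega⟩
    have hInj' : Set.InjOn (Torus.proj (d := 2) (Ls j)) ↑Λ' :=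
      hInj.mono (by exact_mod_cast subset_thicken Λ' 1)
    -- the sector `(rectN n L, 0) = (2 nh, 0)`
    set nh : ℕ := ⌊n * ((Ls j : ℕ) : ℝ) ^ 2 / 2⌋₊ with hnh
    have hrect : ThermodynamicLimit.rectN n (Ls j) = 2 * nh := rfl
    have hn : nh ≤ Fintype.card (FermionTorus 2 (Ls j)) := half_rectN_le_card_aff hn0 hn2.le (Ls j)
    obtain ⟨hψK, -, hHψ⟩ := hψ j
    rw [hrect] at hψK hHψ
    rw [← groundEnergy_hubbardTorusTT'_eq_minEnergyOn_szSector (Ls j) t t' U hn] at hHψ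
    have h := re_orbitState_ge_of_window_certificate_d4_TT'_ineq t t' U hL3 hΛ h8 h0 hz hInj hInj' h1 hmul
      hψK (hψ1 j) hHψ Xw κ u μ ν hΛm O s B tt γ hγS wv hsh Y uu b cw hcw ah dc V w a word hcert
    rw [re_orbitState_spaceGroupUnitary_fermionEmbed_toTorusEmb S hInj'] at h
    have hcast : (nh : ℝ) = (ThermodynamicLimit.rectN n (Ls j) : ℝ) / 2 := by
      rw [hrect]; push_cast; ring
    rw [hcast, ← hrect] at h
    simp_rw [torusAvgExpect_eq]
    exact h
  exact le_of_tendsto_of_tendsto hbnd hlim hev'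

/-- **AFFINE thermodynamic-limit edge, TWO energy slots** (the emitted shape of an SDP window
certificate: a cap multiplier `κhi` on the row `ω(E_Φ) ≤ hi` and a floor multiplier `κlo` on
`lo ≤ ω(E_Φ)`; neither sign nor window is assumed). Identity in `𝔄_{Λ'}`
`X − c·1 − Σ_σ μ_σ (n_{0σ} − ν·1) − κhi (hi·1 − Γ E_Φ) − κlo (Γ E_Φ − lo·1) = (Han's families)` ⟹ for
every torus limit `ω` of unit sector ground states (hypotheses of `…_TT'_affine`),
`c − Σₖ ‖aₖ‖ + (Σ_σ μ_σ)(n/2 − ν) + κhi (hi − e₀) + κlo (e₀ − lo) ≤ |S|⁻¹ Σ_{γ∈S} Re ω_{γΛ'}(Γ(d4Emb γ 0) X)`.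
Reduction to one slot: `κ := κhi − κlo`, `u := 0`, constant `c + κhi·hi − κlo·lo`.
Wang et al. 2024 §III; Boyd–Vandenberghe §5.6. [cite: WangEtAl2024, §III] -/
theorem InfVolFermionState.IsTorusLimitOf.re_sum_expect_d4_ge_of_window_certificate_TT'_affine₂
    (t t' : ℝ) {U : ℝ} (hU : 0 ≤ U) {n : ℝ} (hn0 : 0 ≤ n) (hn2 : n < 2) (κhi hi κlo lo : ℝ)
    {Λ Λ' : Finset (Site 2)} (hΛ : Λ ⊆ Λ') (h8 : thicken Λ 1 ⊆ Λ')
    (h0 : thicken ({0} : Finset (Site 2)) 1 ⊆ Λ') (hz : (0 : Site 2) ∈ Λ')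
    {S : Finset (DihedralGroup 4)} (h1 : (1 : DihedralGroup 4) ∈ S) (hmul : ∀ a ∈ S, ∀ b ∈ S, a * b ∈ S)
    (Xw : FermionOp Λ') (μ : Fin 2 → ℝ) (ν : ℝ)
    {m : Type*} [Fintype m] [DecidableEq m] {Λm : Matrix m m ℂ} (hΛm : Λm.PosSemidef)
    (O : m → FermionOp Λ')
    {κ' : Type*} (s : Finset κ') (B : κ' → FermionOp Λ)
    {ι : Type*} (tt : Finset ι) (γ : ι → DihedralGroup 4) (hγS : ∀ l ∈ tt, γ l ∈ S) (wv : ι → Site 2)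
    (hsh : ∀ l, d4ShiftSet (γ l) (wv l) Λ ⊆ Λ') (Y : ι → FermionOp Λ)
    {ρ : Type*} (uu : Finset ρ) (b : ρ → ℂ) (cw : ρ → List (Orb (PolySite Λ') × Bool))
    (hcw : ∀ j ∈ uu, ladderCharge (cw j) ≠ 0 ∨ ladderSpinCharge (cw j) ≠ 0)
    {δ : Type*} (ah : Finset δ) (dc : δ → ℝ) (V : δ → FermionOp Λ')
    {κ'' : Type*} (w : Finset κ'') (a : κ'' → ℂ) (word : κ'' → List (Orb (PolySite Λ') × Bool)) {c : ℝ}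
    (hcert : Xw - (c : ℂ) • (1 : FermionOp Λ') -
        ∑ σ : Fin 2, ((μ σ : ℝ) : ℂ) • (nAt 0 hz σ - ((ν : ℝ) : ℂ) • (1 : FermionOp Λ')) -
        ((κhi : ℝ) : ℂ) • (((hi : ℝ) : ℂ) • (1 : FermionOp Λ') -
          fermionEmbed (PolySite.incl h0) ((hubbardTTPrimeFermionInteraction t t' U).meanEnergyObs 1)) -
        ((κlo : ℝ) : ℂ) • (fermionEmbed (PolySite.incl h0) ((hubbardTTPrimeFermionInteraction t t' U).meanEnergyObs 1) -
          ((lo : ℝ) : ℂ) • (1 : FermionOp Λ')) =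
      gramForm Λm O +
        (∑ k ∈ s, ((hubbardTTPrimeFermionInteraction t t' U).localHamiltonian Λ' * fermionEmbed (PolySite.incl hΛ) (B k) -
            fermionEmbed (PolySite.incl hΛ) (B k) * (hubbardTTPrimeFermionInteraction t t' U).localHamiltonian Λ') +
          ∑ l ∈ tt, (fermionEmbed (PolySite.incl (hsh l)) (fermionEmbed (PolySite.d4Emb (γ l) (wv l) Λ) (Y l)) -
            fermionEmbed (PolySite.incl hΛ) (Y l)) +
          ∑ j ∈ uu, b j • ladderWord (cw j)) +
        (∑ m' ∈ ah, ((dc m' : ℝ) : ℂ) • ((V m')ᴴ - V m') + ∑ k ∈ w, a k • ladderWord (word k)))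
    {Ls : ℕ → ℕ} (hLs : Tendsto Ls atTop atTop)
    {ψ : ∀ L, Fock (Orb (FermionTorus 2 L))}
    (hψ : ∀ j, IsGroundStateInSector (hubbardTorusTT' (Ls j) t t' U)
      (ThermodynamicLimit.rectN n (Ls j)) 0 (ψ (Ls j)))
    (hψ1 : ∀ j, star (ψ (Ls j)) ⬝ᵥ ψ (Ls j) = 1)
    {ω : InfVolFermionState 2} (hω : ω.IsTorusLimitOf ψ Ls) :
    c - ∑ k ∈ w, ‖a k‖ + (∑ σ : Fin 2, μ σ) * (n / 2 - ν) +
        κhi * (hi - ThermodynamicLimit.energyDensityTT' t t' U n) +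
        κlo * (ThermodynamicLimit.energyDensityTT' t t' U n - lo) ≤
      (S.card : ℝ)⁻¹ * ∑ g ∈ S,
        (ω.expect (d4ShiftSet g 0 Λ') (fermionEmbed (PolySite.d4Emb g 0 Λ') Xw)).re := by
  set EΦ := fermionEmbed (PolySite.incl h0) ((hubbardTTPrimeFermionInteraction t t' U).meanEnergyObs 1)
    with hEΦ
  -- the two-slot left-hand side IS the one-slot left-hand side with `κ := κhi − κlo`, `u := 0`,
  -- constant `c + κhi·hi − κlo·lo`
  have hlhs : Xw - ((c + κhi * hi - κlo * lo : ℝ) : ℂ) • (1 : FermionOp Λ') -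
        ∑ σ : Fin 2, ((μ σ : ℝ) : ℂ) • (nAt 0 hz σ - ((ν : ℝ) : ℂ) • (1 : FermionOp Λ')) -
        (((κhi - κlo : ℝ) : ℝ) : ℂ) • ((((0 : ℝ) : ℝ) : ℂ) • (1 : FermionOp Λ') - EΦ) =
      Xw - (c : ℂ) • (1 : FermionOp Λ') -
        ∑ σ : Fin 2, ((μ σ : ℝ) : ℂ) • (nAt 0 hz σ - ((ν : ℝ) : ℂ) • (1 : FermionOp Λ')) -
        ((κhi : ℝ) : ℂ) • (((hi : ℝ) : ℂ) • (1 : FermionOp Λ') - EΦ) -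
        ((κlo : ℝ) : ℂ) • (EΦ - ((lo : ℝ) : ℂ) • (1 : FermionOp Λ')) := by
    push_cast
    module
  have hcert' : Xw - ((c + κhi * hi - κlo * lo : ℝ) : ℂ) • (1 : FermionOp Λ') -
        ∑ σ : Fin 2, ((μ σ : ℝ) : ℂ) • (nAt 0 hz σ - ((ν : ℝ) : ℂ) • (1 : FermionOp Λ')) -
        (((κhi - κlo : ℝ) : ℝ) : ℂ) • ((((0 : ℝ) : ℝ) : ℂ) • (1 : FermionOp Λ') - EΦ) =
      gramForm Λm O +
        (∑ k ∈ s, ((hubbardTTPrimeFermionInteraction t t' U).localHamiltonian Λ' * fermionEmbed (PolySite.incl hΛ) (B k) -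
            fermionEmbed (PolySite.incl hΛ) (B k) * (hubbardTTPrimeFermionInteraction t t' U).localHamiltonian Λ') +
          ∑ l ∈ tt, (fermionEmbed (PolySite.incl (hsh l)) (fermionEmbed (PolySite.d4Emb (γ l) (wv l) Λ) (Y l)) -
            fermionEmbed (PolySite.incl hΛ) (Y l)) +
          ∑ j ∈ uu, b j • ladderWord (cw j)) +
        (∑ m' ∈ ah, ((dc m' : ℝ) : ℂ) • ((V m')ᴴ - V m') + ∑ k ∈ w, a k • ladderWord (word k)) := by
    rw [hlhs, hEΦ]
    exact hcert
  have h := hω.re_sum_expect_d4_ge_of_window_certificate_TT'_affine t t' hU hn0 hn2 (κhi - κlo) 0 hΛ h8 h0 hz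
    h1 hmul Xw μ ν hΛm O s B tt γ hγS wv hsh Y uu b cw hcw ah dc V w a word hcert' hLs hψ hψ1
  have hring : c + κhi * hi - κlo * lo - ∑ k ∈ w, ‖a k‖ + (∑ σ : Fin 2, μ σ) * (n / 2 - ν) +
        (κhi - κlo) * (0 - ThermodynamicLimit.energyDensityTT' t t' U n) =
      c - ∑ k ∈ w, ‖a k‖ + (∑ σ : Fin 2, μ σ) * (n / 2 - ν) +
        κhi * (hi - ThermodynamicLimit.energyDensityTT' t t' U n) +
        κlo * (ThermodynamicLimit.energyDensityTT' t t' U n - lo) := by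
    ring
  rw [hring] at h
  exact h

/-- **Translation-only certificates, affine form.** Under the hypotheses of `…_TT'_affine` with ALL
point-group labels trivial (`γₗ = 1`), every torus limit `ω` of unit sector ground states obeys
`c − Σₖ ‖aₖ‖ + (Σ_σ μ_σ)(n/2 − ν) + κ (u − e₀) ≤ Re ω_{Λ'}(X)` — NO sign hypothesis on `κ`, NO energy
hypothesis. [cite: WangEtAl2024, §III] -/
theorem InfVolFermionState.IsTorusLimitOf.re_expect_ge_of_window_certificate_TT'_affine
    (t t' : ℝ) {U : ℝ} (hU : 0 ≤ U) {n : ℝ} (hn0 : 0 ≤ n) (hn2 : n < 2) (κ u : ℝ)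
    {Λ Λ' : Finset (Site 2)} (hΛ : Λ ⊆ Λ') (h8 : thicken Λ 1 ⊆ Λ')
    (h0 : thicken ({0} : Finset (Site 2)) 1 ⊆ Λ') (hz : (0 : Site 2) ∈ Λ')
    (Xw : FermionOp Λ') (μ : Fin 2 → ℝ) (ν : ℝ)
    {m : Type*} [Fintype m] [DecidableEq m] {Λm : Matrix m m ℂ} (hΛm : Λm.PosSemidef)
    (O : m → FermionOp Λ')
    {κ' : Type*} (s : Finset κ') (B : κ' → FermionOp Λ)
    {ι : Type*} (tt : Finset ι) (γ : ι → DihedralGroup 4) (hγ1 : ∀ l ∈ tt, γ l = 1) (wv : ι → Site 2)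
    (hsh : ∀ l, d4ShiftSet (γ l) (wv l) Λ ⊆ Λ') (Y : ι → FermionOp Λ)
    {ρ : Type*} (uu : Finset ρ) (b : ρ → ℂ) (cw : ρ → List (Orb (PolySite Λ') × Bool))
    (hcw : ∀ j ∈ uu, ladderCharge (cw j) ≠ 0 ∨ ladderSpinCharge (cw j) ≠ 0)
    {δ : Type*} (ah : Finset δ) (dc : δ → ℝ) (V : δ → FermionOp Λ')
    {κ'' : Type*} (w : Finset κ'') (a : κ'' → ℂ) (word : κ'' → List (Orb (PolySite Λ') × Bool)) {c : ℝ}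
    (hcert : Xw - (c : ℂ) • (1 : FermionOp Λ') -
        ∑ σ : Fin 2, ((μ σ : ℝ) : ℂ) • (nAt 0 hz σ - ((ν : ℝ) : ℂ) • (1 : FermionOp Λ')) -
        ((κ : ℝ) : ℂ) • (((u : ℝ) : ℂ) • (1 : FermionOp Λ') -
          fermionEmbed (PolySite.incl h0) ((hubbardTTPrimeFermionInteraction t t' U).meanEnergyObs 1)) =
      gramForm Λm O +
        (∑ k ∈ s, ((hubbardTTPrimeFermionInteraction t t' U).localHamiltonian Λ' * fermionEmbed (PolySite.incl hΛ) (B k) -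
            fermionEmbed (PolySite.incl hΛ) (B k) * (hubbardTTPrimeFermionInteraction t t' U).localHamiltonian Λ') +
          ∑ l ∈ tt, (fermionEmbed (PolySite.incl (hsh l)) (fermionEmbed (PolySite.d4Emb (γ l) (wv l) Λ) (Y l)) -
            fermionEmbed (PolySite.incl hΛ) (Y l)) +
          ∑ j ∈ uu, b j • ladderWord (cw j)) +
        (∑ m' ∈ ah, ((dc m' : ℝ) : ℂ) • ((V m')ᴴ - V m') + ∑ k ∈ w, a k • ladderWord (word k)))
    {Ls : ℕ → ℕ} (hLs : Tendsto Ls atTop atTop)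
    {ψ : ∀ L, Fock (Orb (FermionTorus 2 L))}
    (hψ : ∀ j, IsGroundStateInSector (hubbardTorusTT' (Ls j) t t' U)
      (ThermodynamicLimit.rectN n (Ls j)) 0 (ψ (Ls j)))
    (hψ1 : ∀ j, star (ψ (Ls j)) ⬝ᵥ ψ (Ls j) = 1)
    {ω : InfVolFermionState 2} (hω : ω.IsTorusLimitOf ψ Ls) :
    c - ∑ k ∈ w, ‖a k‖ + (∑ σ : Fin 2, μ σ) * (n / 2 - ν) +
        κ * (u - ThermodynamicLimit.energyDensityTT' t t' U n) ≤ (ω.expect Λ' Xw).re := by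
  have h1 : (1 : DihedralGroup 4) ∈ ({1} : Finset (DihedralGroup 4)) := Finset.mem_singleton_self 1
  have hmul : ∀ a ∈ ({1} : Finset (DihedralGroup 4)), ∀ b ∈ ({1} : Finset (DihedralGroup 4)),
      a * b ∈ ({1} : Finset (DihedralGroup 4)) := by
    intro a ha b hb
    rw [Finset.mem_singleton] at ha hb ⊢
    rw [ha, hb, mul_one]
  have hγS : ∀ l ∈ tt, γ l ∈ ({1} : Finset (DihedralGroup 4)) := fun l hl =>
    Finset.mem_singleton.2 (hγ1 l hl)
  have h := hω.re_sum_expect_d4_ge_of_window_certificate_TT'_affine t t' hU hn0 hn2 κ u hΛ h8 h0 hz h1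
    hmul Xw μ ν hΛm O s B tt γ hγS wv hsh Y uu b cw hcw ah dc V w a word hcert hLs hψ hψ1
  rwa [Finset.sum_singleton, Finset.card_singleton, Nat.cast_one, inv_one, one_mul,
    ω.expect_fermionEmbed_d4Emb_one_zero] at h

/-- **Translation-only certificates, affine form with two energy slots.** As `…_TT'_affine₂` with
`S = {1}`: `c − Σₖ ‖aₖ‖ + (Σ_σ μ_σ)(n/2 − ν) + κhi (hi − e₀) + κlo (e₀ − lo) ≤ Re ω_{Λ'}(X)`.
[cite: WangEtAl2024, §III] -/
theorem InfVolFermionState.IsTorusLimitOf.re_expect_ge_of_window_certificate_TT'_affine₂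
    (t t' : ℝ) {U : ℝ} (hU : 0 ≤ U) {n : ℝ} (hn0 : 0 ≤ n) (hn2 : n < 2) (κhi hi κlo lo : ℝ)
    {Λ Λ' : Finset (Site 2)} (hΛ : Λ ⊆ Λ') (h8 : thicken Λ 1 ⊆ Λ')
    (h0 : thicken ({0} : Finset (Site 2)) 1 ⊆ Λ') (hz : (0 : Site 2) ∈ Λ')
    (Xw : FermionOp Λ') (μ : Fin 2 → ℝ) (ν : ℝ)
    {m : Type*} [Fintype m] [DecidableEq m] {Λm : Matrix m m ℂ} (hΛm : Λm.PosSemidef)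
    (O : m → FermionOp Λ')
    {κ' : Type*} (s : Finset κ') (B : κ' → FermionOp Λ)
    {ι : Type*} (tt : Finset ι) (γ : ι → DihedralGroup 4) (hγ1 : ∀ l ∈ tt, γ l = 1) (wv : ι → Site 2)
    (hsh : ∀ l, d4ShiftSet (γ l) (wv l) Λ ⊆ Λ') (Y : ι → FermionOp Λ)
    {ρ : Type*} (uu : Finset ρ) (b : ρ → ℂ) (cw : ρ → List (Orb (PolySite Λ') × Bool))
    (hcw : ∀ j ∈ uu, ladderCharge (cw j) ≠ 0 ∨ ladderSpinCharge (cw j) ≠ 0)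
    {δ : Type*} (ah : Finset δ) (dc : δ → ℝ) (V : δ → FermionOp Λ')
    {κ'' : Type*} (w : Finset κ'') (a : κ'' → ℂ) (word : κ'' → List (Orb (PolySite Λ') × Bool)) {c : ℝ}
    (hcert : Xw - (c : ℂ) • (1 : FermionOp Λ') -
        ∑ σ : Fin 2, ((μ σ : ℝ) : ℂ) • (nAt 0 hz σ - ((ν : ℝ) : ℂ) • (1 : FermionOp Λ')) -
        ((κhi : ℝ) : ℂ) • (((hi : ℝ) : ℂ) • (1 : FermionOp Λ') -
          fermionEmbed (PolySite.incl h0) ((hubbardTTPrimeFermionInteraction t t' U).meanEnergyObs 1)) -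
        ((κlo : ℝ) : ℂ) • (fermionEmbed (PolySite.incl h0) ((hubbardTTPrimeFermionInteraction t t' U).meanEnergyObs 1) -
          ((lo : ℝ) : ℂ) • (1 : FermionOp Λ')) =
      gramForm Λm O +
        (∑ k ∈ s, ((hubbardTTPrimeFermionInteraction t t' U).localHamiltonian Λ' * fermionEmbed (PolySite.incl hΛ) (B k) -
            fermionEmbed (PolySite.incl hΛ) (B k) * (hubbardTTPrimeFermionInteraction t t' U).localHamiltonian Λ') +
          ∑ l ∈ tt, (fermionEmbed (PolySite.incl (hsh l)) (fermionEmbed (PolySite.d4Emb (γ l) (wv l) Λ) (Y l)) -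
            fermionEmbed (PolySite.incl hΛ) (Y l)) +
          ∑ j ∈ uu, b j • ladderWord (cw j)) +
        (∑ m' ∈ ah, ((dc m' : ℝ) : ℂ) • ((V m')ᴴ - V m') + ∑ k ∈ w, a k • ladderWord (word k)))
    {Ls : ℕ → ℕ} (hLs : Tendsto Ls atTop atTop)
    {ψ : ∀ L, Fock (Orb (FermionTorus 2 L))}
    (hψ : ∀ j, IsGroundStateInSector (hubbardTorusTT' (Ls j) t t' U)
      (ThermodynamicLimit.rectN n (Ls j)) 0 (ψ (Ls j)))
    (hψ1 : ∀ j, star (ψ (Ls j)) ⬝ᵥ ψ (Ls j) = 1)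
    {ω : InfVolFermionState 2} (hω : ω.IsTorusLimitOf ψ Ls) :
    c - ∑ k ∈ w, ‖a k‖ + (∑ σ : Fin 2, μ σ) * (n / 2 - ν) +
        κhi * (hi - ThermodynamicLimit.energyDensityTT' t t' U n) +
        κlo * (ThermodynamicLimit.energyDensityTT' t t' U n - lo) ≤ (ω.expect Λ' Xw).re := by
  have h1 : (1 : DihedralGroup 4) ∈ ({1} : Finset (DihedralGroup 4)) := Finset.mem_singleton_self 1
  have hmul : ∀ a ∈ ({1} : Finset (DihedralGroup 4)), ∀ b ∈ ({1} : Finset (DihedralGroup 4)),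
      a * b ∈ ({1} : Finset (DihedralGroup 4)) := by
    intro a ha b hb
    rw [Finset.mem_singleton] at ha hb ⊢
    rw [ha, hb, mul_one]
  have hγS : ∀ l ∈ tt, γ l ∈ ({1} : Finset (DihedralGroup 4)) := fun l hl =>
    Finset.mem_singleton.2 (hγ1 l hl)
  have h := hω.re_sum_expect_d4_ge_of_window_certificate_TT'_affine₂ t t' hU hn0 hn2 κhi hi κlo lo hΛ h8 h0
    hz h1 hmul Xw μ ν hΛm O s B tt γ hγS wv hsh Y uu b cw hcw ah dc V w a word hcert hLs hψ hψ1
  rwa [Finset.sum_singleton, Finset.card_singleton, Nat.cast_one, inv_one, one_mul,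
    ω.expect_fermionEmbed_d4Emb_one_zero] at h

end Limit

end Literature.MathematicalPhysics.QuantumLattice

end
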